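import Literature.Computability.Cryptography.PeriodFindingCosetPoisson
import HarnessLib

/-!
# Dual angles of the characters of `ℤ^T/Λ`, and distances to `ℤ`

Topic `Computability/Cryptography` (harmonic analysis of period finding over `ℤ^T`); theorem-only file, no named facts.
Sequel of `PeriodFindingCosetPoisson.lean`; a brick of the per-unit sampling law of a shift-cell / coset table
(the class-group stage of the crux `LinnikCubicClassGroups.PureCubicClassGroupFBQP`).

For a finite-index subgroup `Λ ≤ ℤ^T` (`h = |ℤ^T/Λ|`), every character `χ` of `ℤ^T/Λ` has ANGLES `ξ_χ ∈ ([0,1) ∩ ℚ)^T`: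
`χ(ē_t) = e(ξ_χ t)` with `ξ_χ t = j/h` (`χ(ē_t)` is an `h`-th root of unity). The vector `ξ_χ` pairs integrally with `Λ`
(it represents an element of the dual lattice `Λ^*` modulo `ℤ^T`), and distinct characters have distinct angle vectors.
Conversely two distinct vectors of `[0,1)^T` pairing integrally with `Λ` differ, in some coordinate, by at least `1/h`
modulo `ℤ`. These are the facts that identify the "accurate outcomes" of Fourier sampling a coset table (read through the
rational angle vectors) with the windows of the characters (read through `χ`).

* `addChar_apply_mk_eq_prod` — `χ(v̄) = ∏_t χ(ē_t)^{v_t}`;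
* `exists_dualAngles` — the angle map `χ ↦ ξ_χ`: entries in `[0,1)`, `χ(ē_t) = e(ξ_χ t)`, integral pairing with `Λ`,
  injective;
* `exists_sub_eq_div_index`, `exists_inv_index_le_abs_sub_round` — separation of dual vectors by `1/h` modulo `ℤ`;
* `abs_sub_round_of_eq_add_int`, `abs_sub_round_lt_of_window`, `inv_le_abs_div_sub_int` — bookkeeping for the distance
  to the nearest integer `|y − round y| = min(fract y, 1 − fract y)`.

## References

* A. Yu. Kitaev, arXiv:quant-ph/9511026 (1995), §4. [Kitaev1995]
* S. Hallgren, STOC 2005, §4. [Hallgren2005]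
-/

noncomputable section

namespace Literature.Computability.Cryptography

namespace PeriodFinding

open Complex Finset

variable {T : ℕ}

/-! ### Distance to the nearest integer -/

/-- Two numbers congruent modulo `ℤ` have the same distance to `ℤ` (the `1`-periodicity `|x + k − round(x + k)| =
|x − round x|` is `Literature.NumberTheory.Sieve.Teravainen2024.abs_sub_round_add_int`; the triangle inequality and the
evenness of the distance are `…abs_sub_round_sub_le`, `Literature.NumberTheory.LFunctions.FordVK.abs_neg_sub_round`).
[folklore] -/
theorem abs_sub_round_of_eq_add_int {a b : ℝ} {n : ℤ} (h : a = b + n) : |a - round a| = |b - round b| := by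
  rw [h, round_add_intCast]; push_cast; ring_nf

/-- From the window form `M · min(fract y, 1 − fract y) < u` to the distance form `|y − round y| < u/M`. [folklore] -/
theorem abs_sub_round_lt_of_window {M : ℕ} (hM : 0 < M) {u : ℝ} {y : ℝ}
    (h : (M : ℝ) * min (Int.fract y) (1 - Int.fract y) < u) : |y - round y| < u / M := by
  have hMR : (0 : ℝ) < M := by exact_mod_cast hM
  rw [abs_sub_round_eq_min, lt_div_iff₀ hMR, mul_comm]
  exact h

/-- For an integer `m` that is not a multiple of `h > 0`, `m/h` is at distance `≥ 1/h` from every integer. [folklore] -/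
theorem inv_le_abs_div_sub_int {h : ℕ} (hh : 0 < h) {m : ℤ} (hm : ¬ (h : ℤ) ∣ m) (n : ℤ) :
    (1 : ℝ) / h ≤ |(m : ℝ) / h - n| := by
  have hhR : (0 : ℝ) < h := by exact_mod_cast hh
  have hne : m - n * h ≠ 0 := by
    intro h0
    exact hm ⟨n, by linarith⟩
  have h1 : (1 : ℝ) ≤ |((m - n * h : ℤ) : ℝ)| := by
    rw [← Int.cast_abs]
    exact_mod_cast Int.one_le_abs hne
  rw [show (m : ℝ) / h - n = ((m - n * h : ℤ) : ℝ) / h by push_cast; field_simp, abs_div, abs_of_pos hhR,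
    div_le_div_iff_of_pos_right hhR]
  exact h1

/-! ### Characters through their values on the unit vectors -/

section Lattice

variable (Λ : AddSubgroup (Fin T → ℤ))

/-- A character of `ℤ^T/Λ` on the class of `v` is the product of the powers of its values on the unit vectors:
`χ(v̄) = ∏_t χ(ē_t)^{v_t}`. [folklore] -/
theorem addChar_apply_mk_eq_prod (χ : AddChar ((Fin T → ℤ) ⧸ Λ) ℂ) (v : Fin T → ℤ) :
    χ (QuotientAddGroup.mk v) = ∏ t : Fin T, χ (QuotientAddGroup.mk (Pi.single t 1)) ^ (v t) := by
  have hv : v = ∑ t : Fin T, (v t) • (Pi.single t (1 : ℤ) : Fin T → ℤ) := by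
    ext j; simp [Finset.sum_apply, Pi.single_apply]
  conv_lhs => rw [hv]
  show χ ((QuotientAddGroup.mk' Λ) (∑ t, v t • (Pi.single t (1 : ℤ) : Fin T → ℤ))) = _
  rw [map_sum, addChar_map_sum]
  refine prod_congr rfl fun t _ => ?_
  rw [map_zsmul, AddChar.map_zsmul_eq_zpow]
  rfl

/-- Two characters of `ℤ^T/Λ` that agree on the unit vectors are equal. [folklore] -/
theorem addChar_ext_single (χ χ' : AddChar ((Fin T → ℤ) ⧸ Λ) ℂ)
    (h : ∀ t : Fin T, χ (QuotientAddGroup.mk (Pi.single t 1)) = χ' (QuotientAddGroup.mk (Pi.single t 1))) : χ = χ' := by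
  refine AddChar.ext _ _ fun a => ?_
  obtain ⟨v, rfl⟩ := QuotientAddGroup.mk_surjective a
  rw [addChar_apply_mk_eq_prod, addChar_apply_mk_eq_prod]
  exact prod_congr rfl fun t _ => by rw [h t]

variable [Fintype ((Fin T → ℤ) ⧸ Λ)]

/-- Every value `χ(ē_t)` is `e(j/h)` for some `j < h = |ℤ^T/Λ|` (an `h`-th root of unity). [folklore] -/
theorem exists_apply_single_eq_exp (χ : AddChar ((Fin T → ℤ) ⧸ Λ) ℂ) (t : Fin T) :
    ∃ j : ℕ, j < Fintype.card ((Fin T → ℤ) ⧸ Λ) ∧ χ (QuotientAddGroup.mk (Pi.single t 1)) =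
      cexp (2 * Real.pi * I * ((((j : ℚ) / Fintype.card ((Fin T → ℤ) ⧸ Λ) : ℚ) : ℝ) : ℂ)) := by
  set h := Fintype.card ((Fin T → ℤ) ⧸ Λ) with hh
  have hhpos : 0 < h := Fintype.card_pos
  set z : ℂ := χ (QuotientAddGroup.mk (Pi.single t 1) : ((Fin T → ℤ) ⧸ Λ)) with hz
  have hzh : z ^ h = 1 := by
    rw [hz, ← AddChar.map_nsmul_eq_pow, hh, card_nsmul_eq_zero, AddChar.map_zero_eq_one]
  have hζ : IsPrimitiveRoot (cexp (2 * Real.pi * I / h)) h := Complex.isPrimitiveRoot_exp h hhpos.ne'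
  haveI : NeZero h := ⟨hhpos.ne'⟩
  obtain ⟨j, hjh, hjz⟩ := hζ.eq_pow_of_pow_eq_one hzh
  refine ⟨j, hjh, ?_⟩
  rw [← hjz, ← Complex.exp_nat_mul]
  congr 1
  have hhC : (h : ℂ) ≠ 0 := by exact_mod_cast hhpos.ne'
  push_cast
  field_simp

end Lattice

/-- **Dual angles of the characters.** There is an angle map `ξ : (ℤ^T/Λ)^ → ([0,1) ∩ ℚ)^T` with `χ(ē_t) = e(ξ_χ t)`,
every `ξ_χ` pairing integrally with `Λ` (it represents an element of `Λ^*/ℤ^T`), and `ξ` injective.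
[cite: Kitaev1995, §4] -/
theorem exists_dualAngles : ∀ {T : ℕ} (Λ : AddSubgroup (Fin T → ℤ)) [Fintype ((Fin T → ℤ) ⧸ Λ)],
    ∃ ξ : AddChar ((Fin T → ℤ) ⧸ Λ) ℂ → Fin T → ℚ,
      (∀ χ t, 0 ≤ ξ χ t ∧ ξ χ t < 1) ∧
      (∀ χ t, χ (QuotientAddGroup.mk (Pi.single t 1)) = Complex.exp (2 * Real.pi * Complex.I * ((ξ χ t : ℝ) : ℂ))) ∧
      (∀ χ, ∀ v ∈ Λ, ∃ z : ℤ, ∑ t, ξ χ t * (v t : ℚ) = z) ∧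
      Function.Injective ξ := by
  intro T Λ _
  set h := Fintype.card ((Fin T → ℤ) ⧸ Λ) with hh
  have hhpos : 0 < h := Fintype.card_pos
  have hhQ : (0 : ℚ) < h := by exact_mod_cast hhpos
  choose j hj hjχ using fun (χ : AddChar ((Fin T → ℤ) ⧸ Λ) ℂ) (t : Fin T) => exists_apply_single_eq_exp Λ χ t
  refine ⟨fun χ t => (j χ t : ℚ) / h, fun χ t => ⟨by positivity, ?_⟩, fun χ t => hjχ χ t, fun χ v hv => ?_,
    fun χ χ' hχχ => ?_⟩
  · rw [div_lt_one hhQ]; exact_mod_cast hj χ t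
  · -- `e(∑ ξ_t v_t) = χ(v̄) = 1`
    have hprod : cexp (2 * Real.pi * I * (((∑ t, (j χ t : ℚ) / h * (v t : ℚ) : ℚ) : ℝ) : ℂ)) =
        χ (QuotientAddGroup.mk v) := by
      rw [addChar_apply_mk_eq_prod]
      push_cast
      rw [Finset.mul_sum, Complex.exp_sum]
      refine prod_congr rfl fun t _ => ?_
      rw [hjχ χ t, ← Complex.exp_int_mul]
      congr 1
      push_cast
      ring
    have hone : χ (QuotientAddGroup.mk v) = 1 := by
      rw [(QuotientAddGroup.eq_zero_iff v).2 hv, AddChar.map_zero_eq_one]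
    rw [hone] at hprod
    obtain ⟨n, hn⟩ := Complex.exp_eq_one_iff.1 hprod
    refine ⟨n, ?_⟩
    have h2pi : (2 * Real.pi * I : ℂ) ≠ 0 := by
      simp [Real.pi_ne_zero, Complex.I_ne_zero]
    have hC : (((∑ t, (j χ t : ℚ) / h * (v t : ℚ) : ℚ) : ℝ) : ℂ) = (n : ℂ) := by
      refine mul_right_cancel₀ h2pi ?_
      rw [← hn, mul_comm]
    have hR : ((∑ t, (j χ t : ℚ) / h * (v t : ℚ) : ℚ) : ℝ) = (n : ℝ) := by exact_mod_cast hC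
    exact_mod_cast hR
  · -- injectivity: the values on the unit vectors agree
    refine addChar_ext_single Λ χ χ' fun t => ?_
    rw [hjχ χ t, hjχ χ' t]
    have := congrFun hχχ t
    simp only at this
    rw [this]

/-! ### Separation of dual vectors -/

/-- Two vectors pairing integrally with a finite-index `Λ ≤ ℤ^T` differ coordinatewise by multiples of `1/[ℤ^T:Λ]`
(pair with `[ℤ^T:Λ]·e_t ∈ Λ`). [folklore] -/
theorem exists_sub_eq_div_index (Λ : AddSubgroup (Fin T → ℤ)) [Λ.FiniteIndex] (ξ ξ' : Fin T → ℚ)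
    (hξ : ∀ v ∈ Λ, ∃ z : ℤ, ∑ t, ξ t * (v t : ℚ) = z) (hξ' : ∀ v ∈ Λ, ∃ z : ℤ, ∑ t, ξ' t * (v t : ℚ) = z) (t : Fin T) :
    ∃ m : ℤ, ξ t - ξ' t = (m : ℚ) / Λ.index := by
  have h0 : (Λ.index : ℚ) ≠ 0 := by exact_mod_cast AddSubgroup.FiniteIndex.index_ne_zero
  have hmem : Λ.index • (Pi.single t (1 : ℤ) : Fin T → ℤ) ∈ Λ := AddSubgroup.nsmul_index_mem Λ _
  have hpair : ∀ ζ : Fin T → ℚ, ∑ s, ζ s * ((Λ.index • (Pi.single t (1 : ℤ) : Fin T → ℤ)) s : ℚ) = ζ t * Λ.index := by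
    intro ζ
    rw [Finset.sum_eq_single t]
    · simp
    · intro s _ hs; simp [hs]
    · intro ht; exact absurd (mem_univ t) ht
  obtain ⟨z, hz⟩ := hξ _ hmem
  obtain ⟨z', hz'⟩ := hξ' _ hmem
  rw [hpair] at hz hz'
  refine ⟨z - z', ?_⟩
  push_cast
  rw [← hz, ← hz']
  field_simp

/-- **Separation of dual vectors**: two distinct vectors of `[0,1)^T` pairing integrally with `Λ` differ, in some
coordinate, by at least `1/[ℤ^T:Λ]` modulo `ℤ`. [cite: Kitaev1995, §4] -/
theorem exists_inv_index_le_abs_sub_round (Λ : AddSubgroup (Fin T → ℤ)) [Λ.FiniteIndex] (ξ ξ' : Fin T → ℚ)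
    (h01 : ∀ t, 0 ≤ ξ t ∧ ξ t < 1) (h01' : ∀ t, 0 ≤ ξ' t ∧ ξ' t < 1)
    (hξ : ∀ v ∈ Λ, ∃ z : ℤ, ∑ t, ξ t * (v t : ℚ) = z) (hξ' : ∀ v ∈ Λ, ∃ z : ℤ, ∑ t, ξ' t * (v t : ℚ) = z)
    (hne : ξ ≠ ξ') (a : Fin T → ℝ) :
    ∃ t : Fin T, (1 : ℝ) / Λ.index ≤
      |(a t + ξ t) - (a t + ξ' t) - round ((a t + ξ t) - (a t + ξ' t))| := by
  have hidx : 0 < Λ.index := Nat.pos_of_ne_zero AddSubgroup.FiniteIndex.index_ne_zero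
  obtain ⟨t, ht⟩ : ∃ t, ξ t ≠ ξ' t := by
    by_contra hall
    push Not at hall
    exact hne (funext hall)
  obtain ⟨m, hm⟩ := exists_sub_eq_div_index Λ ξ ξ' hξ hξ' t
  refine ⟨t, ?_⟩
  -- `m` is not a multiple of the index: `0 < |m| < index`
  have hndvd : ¬ (Λ.index : ℤ) ∣ m := by
    rintro ⟨n, hn⟩
    have hlt : |ξ t - ξ' t| < 1 := by
      rw [abs_sub_lt_iff]
      constructor <;> linarith [(h01 t).1, (h01 t).2, (h01' t).1, (h01' t).2]
    rw [hm, hn] at hlt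
    have h0 : (Λ.index : ℚ) ≠ 0 := by exact_mod_cast hidx.ne'
    have : |(n : ℚ)| < 1 := by
      push_cast at hlt
      rw [show (Λ.index : ℚ) * n / Λ.index = n by field_simp] at hlt
      exact hlt
    have hn0 : n = 0 := by
      have h1 : |n| < 1 := by exact_mod_cast this
      have h2 := abs_lt.1 h1
      omega
    subst hn0
    apply ht
    have : ξ t - ξ' t = 0 := by rw [hm, hn]; simp
    linarith
  have hdiff : (a t + ξ t) - (a t + ξ' t) = ((m : ℝ) / Λ.index : ℝ) := by
    have : ((ξ t - ξ' t : ℚ) : ℝ) = ((m : ℚ) / Λ.index : ℚ) := by rw [hm]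
    push_cast at this
    linarith
  rw [hdiff]
  exact inv_le_abs_div_sub_int hidx hndvd _

end PeriodFinding

end Literature.Computability.Cryptography
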